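import Summits.QuantumAdvantage.QuantumAdvantage.Theorems.SteerDialStructural

/-!
# SteerDial (6/7): SteerDialWindow

§C.3 — ARBITRARY WINDOW CONTENT: `vinv`/`contentCylinderLoss3_of_polyLoss3` (every width-6 content),
`idCylinderLossG_of_polyLoss3` (every identity word of every length, no certificate hypothesis),
`windowLoss_of_polyLoss3` (EVERY content of EVERY constant width `L` at every offset: loss share `≥
1/(n+L+6)^(k+L+6)`), `juntaLoss_of_polyLoss3` (every partial pattern) — every local-pattern / junta test of constant
span, granted `SpreadDial.PolyLoss3` (26123).

Part 6 of 7 of the prover-side twin of the workshop node «SteerDial» (route `SpreadDial`, node on 29065 `CoverLift3`;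
lineage decomp-qadv-lens-5, generation 7).  Content verbatim from the monolithic twin `tree/SpreadDialSteer.lean`
(sha256 5f501baf…, farm rc0 · 0 err · 0 warn · 0 sorry; axioms `propext`/`Classical.choice`/`Quot.sound` for every theorem),
cut at section boundaries to meet the 400-line rule.  No `def … : Prop`, no `instance`, no `notation`.
-/

set_option linter.style.longLine false
set_option linter.dupNamespace false

namespace Summit.QuantumAdvantage.QuantumAdvantage.Theorems.SteerDial

open Finset
open Literature.Computability.QuantumComplexity Literature.Computability.MetaComplexity
open Literature.Computability.QuantumComplexity.RingHLF
open Summit.QuantumAdvantage.AdviceFreeQNC0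
open Summit.QuantumAdvantage.QuantumAdvantage.Theses

section WindowTheorems
variable {n m : ℕ}

/-- The INVERSE-COMPLETION of a window content: the first `v ∈ {0,1}^6` (binary order) with `T_{v ++ w₀} = 1`
(it always lies among `000000, 100000, 010000, 110000, 011000, 111000` — one per element of `GL₂(𝔽₂) ≅ S₃`). -/
def vinv (w₀ : Fin 6 → Bool) : Fin 6 → Bool :=
  wordOfNat (((List.range 64).find? fun k => idWord (Fin.append (wordOfNat k) w₀)).getD 0)

/-- **Every window content completes to an identity word of length 12** (kernel decision over the 64 contents). -/
theorem idWord_vinv : ∀ w₀ : Fin 6 → Bool, idWord (Fin.append (vinv w₀) w₀) = true := by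
  decide +kernel

/-- … and the completed word carries its canonical certificate. -/
theorem wordCert_vinv :
    ∀ w₀ : Fin 6 → Bool, wordCert (Fin.append (vinv w₀) w₀) (cα (Fin.append (vinv w₀) w₀)) (cβ (Fin.append (vinv w₀) w₀))
      (ca (Fin.append (vinv w₀) w₀)) (cb (Fin.append (vinv w₀) w₀)) = true := by
  decide +kernel

/-- **ContentCylinderLoss3 (PROVED from PolyLoss3): EVERY width-6 window content at EVERY ring position.**
For every `w₀ ∈ {0,1}^6` (all 64 contents — no identity-word restriction), every offset `s` and every polylog-degree
strategy `P` on `C_{n+12}`, the loss set of `P` has `≥ 2^{n+12}/(n+12)^{k}` elements inside the cylinder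
`{x : (rot_s x)_{n+6+j} = (w₀)_j, j < 6}`; i.e. every CONTIGUOUS 6-JUNTA test that accepts at least one window content
satisfies the ‹AlgSpread3› conclusion, whatever its density.  Proof: the length-12 identity cylinder
`{x|_{[n,n+12)} = vinv w₀ ++ w₀}` (`idWord_vinv`, `wordCert_vinv`, `rotCylinderLossG_of_polyLoss3` at `m = 12`) lies inside. -/
theorem contentCylinderLoss3_of_polyLoss3 (hP : SpreadDial.PolyLoss3) :
    ∃ k : ℕ, ∀ c : ℕ, ∃ n₀ : ℕ, ∀ n ≥ n₀, ∀ P : Fin (n + 12) → Smolensky.CubeFn (ZMod 3) (n + 12),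
      (∀ b, P b ∈ Smolensky.lowDeg (ZMod 3) (n + 12) ((Nat.log 2 (n + 12)) ^ c)) →
        ∀ w₀ : Fin 6 → Bool, ∀ s : ℕ,
          1 / ((n + 12 : ℕ) : ℝ) ^ k * (2 : ℝ) ^ (n + 12) ≤
            ((univ.filter fun x : Fin (n + 12) → Bool =>
              (∀ j : Fin 6, rot s x (Fin.natAdd (n + 6) j) = w₀ j) ∧
                ¬ RingHLF.Rel x (fun b => decide (P b x = 1))).card : ℝ) := by
  obtain ⟨k, hk⟩ := rotCylinderLossG_of_polyLoss3 hP 12 (by norm_num)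
  refine ⟨k, fun c => ?_⟩
  obtain ⟨n₀, hn₀⟩ := hk c
  refine ⟨n₀, fun n hn P hPdeg w₀ s => ?_⟩
  have hB := hn₀ n hn P hPdeg (Fin.append (vinv w₀) w₀) _ _ _ _ (wordCert_vinv w₀) s
  refine hB.trans ?_
  have hle : (univ.filter fun x : Fin (n + 12) → Bool =>
        (∀ j : Fin 12, rot s x (Fin.natAdd n j) = Fin.append (vinv w₀) w₀ j) ∧
          ¬ RingHLF.Rel x (fun b => decide (P b x = 1))).card ≤
      (univ.filter fun x : Fin (n + 12) → Bool =>
        (∀ j : Fin 6, rot s x (Fin.natAdd (n + 6) j) = w₀ j) ∧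
          ¬ RingHLF.Rel x (fun b => decide (P b x = 1))).card := by
    refine Finset.card_le_card (fun x hx => ?_)
    rw [Finset.mem_filter] at hx ⊢
    refine ⟨hx.1, fun j => ?_, hx.2.2⟩
    have h := hx.2.1 (Fin.natAdd 6 j)
    rw [Fin.append_right] at h
    have e : (Fin.natAdd n (Fin.natAdd 6 j) : Fin (n + 12)) = Fin.natAdd (n + 6) j := by
      ext; simp [Fin.natAdd]; omega
    rw [← e]; exact h
  exact_mod_cast hle

/-- **IDENTITY CYLINDERS, NO CERTIFICATE HYPOTHESIS.** `PolyLoss3` ⇒ for every `m ≥ 1` and EVERY identity word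
`w ∈ {0,1}^m` (`T_w = 1`), at every ring offset, the cylinder `{x : (rot_s x)_{n+j} = w_j (j < m)}` of `C_{n+m}` carries
`≥ 2^{n+m}/(n+m)^k` losses of every polylog-degree `𝔽₃` strategy (`k = k_P + m`). -/
theorem idCylinderLossG_of_polyLoss3 (hP : SpreadDial.PolyLoss3) (m : ℕ) (hm : 1 ≤ m) :
    ∃ k : ℕ, ∀ c : ℕ, ∃ n₀ : ℕ, ∀ n ≥ n₀, ∀ P : Fin (n + m) → Smolensky.CubeFn (ZMod 3) (n + m),
      (∀ b, P b ∈ Smolensky.lowDeg (ZMod 3) (n + m) ((Nat.log 2 (n + m)) ^ c)) →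
        ∀ w : Fin m → Bool, idWord w = true → ∀ s : ℕ,
          1 / ((n + m : ℕ) : ℝ) ^ k * (2 : ℝ) ^ (n + m) ≤
            ((univ.filter fun x : Fin (n + m) → Bool =>
              (∀ j : Fin m, rot s x (Fin.natAdd n j) = w j) ∧
                ¬ RingHLF.Rel x (fun b => decide (P b x = 1))).card : ℝ) := by
  obtain ⟨k, hk⟩ := rotCylinderLossG_of_polyLoss3 hP m hm
  refine ⟨k, fun c => ?_⟩
  obtain ⟨n₀, hn₀⟩ := hk c
  exact ⟨n₀, fun n hn P hPdeg w hw s => hn₀ n hn P hPdeg w _ _ _ _ (wordCert_of_idWord w hw) s⟩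

/-- **WINDOW THEOREM: EVERY LOCAL PATTERN OF EVERY CONSTANT WIDTH.** `PolyLoss3` ⇒ for every width `L`, there is
`k` (`= k_P + L + 6`) such that for every `c`, all large `n`, every `𝔽₃` strategy of degree `≤ log^c` on the ring
`C_{n+L+6}`, EVERY window content `u ∈ {0,1}^L` and EVERY offset `s`, the cylinder `{x : (rot_s x)_{n+j} = u_j (j < L)}`
contains `≥ 2^{n+L+6}/(n+L+6)^k` losing inputs.  (Device: the six letters after the window are fixed to the inverse
completion `vinvG u`, making `u ⧺ vinvG u` an identity word, certified by the structural theorem.)  Consequently every test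
set containing such a cylinder — in particular every junta / local-pattern test of span `≤ L`, WHATEVER ITS DENSITY — satisfies
the conclusion of AlgSpread3/SpreadLoss3 with polynomial loss. -/
theorem windowLoss_of_polyLoss3 (hP : SpreadDial.PolyLoss3) (L : ℕ) :
    ∃ k : ℕ, ∀ c : ℕ, ∃ n₀ : ℕ, ∀ n ≥ n₀, ∀ P : Fin (n + (L + 6)) → Smolensky.CubeFn (ZMod 3) (n + (L + 6)),
      (∀ b, P b ∈ Smolensky.lowDeg (ZMod 3) (n + (L + 6)) ((Nat.log 2 (n + (L + 6))) ^ c)) →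
        ∀ u : Fin L → Bool, ∀ s : ℕ,
          1 / ((n + (L + 6) : ℕ) : ℝ) ^ k * (2 : ℝ) ^ (n + (L + 6)) ≤
            ((univ.filter fun x : Fin (n + (L + 6)) → Bool =>
              (∀ j : Fin L, rot s x (Fin.natAdd n (Fin.castAdd 6 j)) = u j) ∧
                ¬ RingHLF.Rel x (fun b => decide (P b x = 1))).card : ℝ) := by
  obtain ⟨k, hk⟩ := rotCylinderLossG_of_polyLoss3 hP (L + 6) (by omega)
  refine ⟨k, fun c => ?_⟩
  obtain ⟨n₀, hn₀⟩ := hk c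
  refine ⟨n₀, fun n hn P hPdeg u s => ?_⟩
  have hB := hn₀ n hn P hPdeg (Fin.append u (vinvG u)) _ _ _ _ (wordCert_append_vinvG u) s
  refine hB.trans ?_
  have hle : (univ.filter fun x : Fin (n + (L + 6)) → Bool =>
        (∀ j : Fin (L + 6), rot s x (Fin.natAdd n j) = Fin.append u (vinvG u) j) ∧
          ¬ RingHLF.Rel x (fun b => decide (P b x = 1))).card ≤
      (univ.filter fun x : Fin (n + (L + 6)) → Bool =>
        (∀ j : Fin L, rot s x (Fin.natAdd n (Fin.castAdd 6 j)) = u j) ∧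
          ¬ RingHLF.Rel x (fun b => decide (P b x = 1))).card := by
    refine Finset.card_le_card (fun x hx => ?_)
    rw [Finset.mem_filter] at hx ⊢
    refine ⟨hx.1, fun j => ?_, hx.2.2⟩
    have h := hx.2.1 (Fin.castAdd 6 j)
    rw [Fin.append_left] at h
    exact h
  exact_mod_cast hle

/-- **JUNTA COROLLARY.** Same, for every PARTIAL pattern: any set `J` of positions inside the width-`L` window and
any prescribed bits on `J` (a junta test of span `≤ L`, of density `2^{-|J|}`, far outside the dense regime). -/
theorem juntaLoss_of_polyLoss3 (hP : SpreadDial.PolyLoss3) (L : ℕ) :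
    ∃ k : ℕ, ∀ c : ℕ, ∃ n₀ : ℕ, ∀ n ≥ n₀, ∀ P : Fin (n + (L + 6)) → Smolensky.CubeFn (ZMod 3) (n + (L + 6)),
      (∀ b, P b ∈ Smolensky.lowDeg (ZMod 3) (n + (L + 6)) ((Nat.log 2 (n + (L + 6))) ^ c)) →
        ∀ J : Finset (Fin L), ∀ u : Fin L → Bool, ∀ s : ℕ,
          1 / ((n + (L + 6) : ℕ) : ℝ) ^ k * (2 : ℝ) ^ (n + (L + 6)) ≤
            ((univ.filter fun x : Fin (n + (L + 6)) → Bool =>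
              (∀ j ∈ J, rot s x (Fin.natAdd n (Fin.castAdd 6 j)) = u j) ∧
                ¬ RingHLF.Rel x (fun b => decide (P b x = 1))).card : ℝ) := by
  obtain ⟨k, hk⟩ := windowLoss_of_polyLoss3 hP L
  refine ⟨k, fun c => ?_⟩
  obtain ⟨n₀, hn₀⟩ := hk c
  refine ⟨n₀, fun n hn P hPdeg J u s => (hn₀ n hn P hPdeg u s).trans ?_⟩
  exact_mod_cast Finset.card_le_card (fun x hx => by
    rw [Finset.mem_filter] at hx ⊢
    exact ⟨hx.1, fun j _ => hx.2.1 j, hx.2.2⟩)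

end WindowTheorems

end Summit.QuantumAdvantage.QuantumAdvantage.Theorems.SteerDial
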